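import Mathlib
import Summits.Ventures.PercRepro2.Defs
import Summits.Ventures.PercRepro2.Independence
import Summits.Ventures.PercRepro2.Harris
import Summits.Ventures.PercRepro2.Graph
import Summits.Ventures.PercRepro2.Events
import Summits.Ventures.PercRepro2.GateCylinder
import Summits.Ventures.PercRepro2.CDNestedInternal
import Summits.Ventures.PercRepro2.CDNestedRoutes
import Summits.Ventures.PercRepro2.CDNestedFan

/-!
# Row 2′CD on the fan graphs themselves, with no route hypothesis (blind cell PercRepro2, mine-a g35;
MINE-A.md §90.4, proofs/MINEA-CD-NESTED.md §5)

The PURE fan `F_m`: vertices `x 0, …, x m` (distinct) and the hub `a₃` (not on the path), edges = the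
rungs `r j = {x j, x (j+1)}` (`j < m`) and the spokes `c i = {x i, a₃}` (`i ≤ m`), nothing else.  Whenever
`a₁ = x 0` is joined to `a₃` by open edges, some route `{r 0, …, r (i-1), c i}` is open
(`fan_route_of_conn`: the set of vertices «`x j` with the rungs before `x j` open, or some route open»
contains `x 0` and is closed under open adjacency — the closure lemma of `Graph.lean`).  Hence row 2′CD
holds on every fan for EVERY placement of `a₂` and `o` on its vertices, every up-set and every weight
vector (`cd_of_fan_graph`) — after the cycles (`CDCycle.cd_cycle`, one route under `Q`), the second
infinite family of graphs on which the row is a kernel fact with no hypothesis beyond the graph, and the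
first with many routes.  No definition; one seat.
-/

namespace Summit.Ventures.PercRepro2

namespace CDNestedFan

section Graph

variable {V : Type*} {E : Type*} [DecidableEq E]

/-- Membership in a route cylinder of the fan. -/
lemma mem_fanCylinder_iff {r c : ℕ → E} {i : ℕ} {ω : Config E} :
    ω ∈ GateCylinder.cylinder (insert (c i) ((Finset.range i).image r)) ↔
      ω (c i) = true ∧ ∀ j, j < i → ω (r j) = true := by
  simp only [GateCylinder.cylinder, Set.mem_setOf_eq, Finset.mem_insert, Finset.mem_image,
    Finset.mem_range, forall_eq_or_imp, forall_exists_index, and_imp]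
  constructor
  · rintro ⟨h1, h2⟩
    exact ⟨h1, fun j hj => h2 (r j) j hj rfl⟩
  · rintro ⟨h1, h2⟩
    exact ⟨h1, fun e j hj he => he ▸ h2 j hj⟩

/-- **On a pure fan, `x 0 ↔ a₃` opens a route**: if every edge is a rung or a spoke, the path vertices
are distinct and the hub is not on the path, then `Conn ω (x 0) a₃` gives an `i ≤ m` with the spoke `c i`
and the rungs `r 0, …, r (i-1)` open. -/
lemma fan_route_of_conn {ends : E → Sym2 V} {a₃ : V} {m : ℕ} {x : ℕ → V} {r c : ℕ → E}
    (hr : ∀ j, j < m → ends (r j) = s(x j, x (j + 1))) (hc : ∀ i, i ≤ m → ends (c i) = s(x i, a₃))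
    (hx : ∀ i j, i ≤ m → j ≤ m → x i = x j → i = j) (ha₃ : ∀ i, i ≤ m → x i ≠ a₃)
    (hE : ∀ e : E, (∃ j, j < m ∧ e = r j) ∨ (∃ i, i ≤ m ∧ e = c i)) {ω : Config E}
    (h : Conn ends ω (x 0) a₃) :
    ∃ i, i < m + 1 ∧ ω ∈ GateCylinder.cylinder (insert (c i) ((Finset.range i).image r)) := by
  -- the invariant: at `x j` with the rungs before it open, or some route open
  let P : Set V := {v | (∃ j, j ≤ m ∧ v = x j ∧ ∀ j', j' < j → ω (r j') = true) ∨
    (∃ i, i ≤ m ∧ ω (c i) = true ∧ ∀ j', j' < i → ω (r j') = true)}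
  have hP : a₃ ∈ P := by
    refine mem_of_conn_of_closed (ends := ends) (ω := ω) (S := P) ?_ ?_ h
    · intro u hu v huv
      obtain ⟨_, e, he, hends⟩ := openGraph_adj.1 huv
      rcases hu with ⟨j, hj, rfl, hrungs⟩ | hroute
      · rcases hE e with ⟨j', hj', rfl⟩ | ⟨i, hi, rfl⟩
        · -- a rung at `x j`: `j' = j` (forward) or `j' + 1 = j` (backward)
          rw [hr j' hj', Sym2.eq_iff] at hends
          rcases hends with ⟨h1, rfl⟩ | ⟨rfl, h2⟩
          · have hjj : j' = j := hx j' j (by omega) hj h1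
            subst hjj
            refine Or.inl ⟨j' + 1, by omega, rfl, fun j'' hj'' => ?_⟩
            rcases Nat.lt_succ_iff_lt_or_eq.1 hj'' with hlt | rfl
            · exact hrungs j'' hlt
            · exact he
          · have hjj : j' + 1 = j := hx (j' + 1) j (by omega) hj h2
            exact Or.inl ⟨j', by omega, rfl, fun j'' hj'' => hrungs j'' (by omega)⟩
        · -- a spoke at `x j`: it is `c j`, and the route `j` is open
          rw [hc i hi, Sym2.eq_iff] at hends
          rcases hends with ⟨h1, rfl⟩ | ⟨_, h2⟩
          · have hij : i = j := hx i j hi hj h1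
            subst hij
            exact Or.inr ⟨i, hi, he, hrungs⟩
          · exact absurd h2.symm (ha₃ j hj)
      · exact Or.inr hroute
    · exact Or.inl ⟨0, Nat.zero_le m, rfl, fun j' hj' => absurd hj' (Nat.not_lt_zero j')⟩
  rcases hP with ⟨j, hj, hja, _⟩ | ⟨i, hi, hci, hrungs⟩
  · exact absurd hja.symm (ha₃ j hj)
  · exact ⟨i, by omega, mem_fanCylinder_iff.2 ⟨hci, hrungs⟩⟩

end Graph

section Theorem

variable {V : Type*} {E : Type*} [Fintype E] [DecidableEq E] [Fintype V] [DecidableEq V]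
  {R : Type*} [Field R] [LinearOrder R] [IsStrictOrderedRing R]

/-- **Row 2′CD on the fans, one-way form with the rungs and spokes only up to `m`** (`cd_of_fan'` with
`hr`, `hc` bounded — the form a finite fan graph supplies). -/
theorem cd_of_fan_bdd (p : E → R) (hp : IsProbVec p) {ends : E → Sym2 V} {a₁ a₂ a₃ o : V} (m : ℕ)
    (x : ℕ → V) (r c : ℕ → E) (hx0 : x 0 = a₁) (hr : ∀ j, j < m → ends (r j) = s(x j, x (j + 1)))
    (hc : ∀ i, i ≤ m → ends (c i) = s(x i, a₃)) {𝓔 : Set (Set V)} (h𝓔 : IsUpperSet 𝓔)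
    (hroute : ∀ ω : Config E, ¬ Conn ends ω a₁ a₂ → Conn ends ω a₁ a₃ →
      ∃ i, i < m + 1 ∧ ω ∈ GateCylinder.cylinder (insert (c i) ((Finset.range i).image r))) :
    let Q := (connEvent ends a₁ a₂)ᶜ
    let U := clusterInEvent ends a₁ 𝓔
    let e := connEvent ends a₁ a₃
    let f := connEvent ends a₂ o
    let N := (connEvent ends a₁ a₃)ᶜ ∩ (connEvent ends a₂ a₃)ᶜ
    let oU := connEvent ends a₁ o ∪ connEvent ends a₂ o
    prob p (Q ∩ N) * (prob p Q * prob p (Q ∩ U ∩ e ∩ f) - prob p (Q ∩ U) * prob p (Q ∩ e ∩ f)) ≤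
      prob p (Q ∩ N ∩ oU) * (prob p Q * prob p (Q ∩ U ∩ e) - prob p (Q ∩ U) * prob p (Q ∩ e)) := by
  intro Q U e f N oU
  set L : ℕ → List (E × V × V) :=
    fun i => (List.range i).map (fun j => (r j, x j, x (j + 1))) ++ [(c i, x i, a₃)] with hL
  have hmem : ∀ i t, t ∈ L i ↔ (∃ j < i, (r j, x j, x (j + 1)) = t) ∨ t = (c i, x i, a₃) := by
    intro i t
    simp [hL, List.mem_append, List.mem_map, List.mem_range]
  have hB : ∀ i, i < m + 1 →
      insert (c i) ((Finset.range i).image r) = (L i).foldl (fun acc t => insert t.1 acc) ∅ := by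
    intro i _
    ext b
    rw [CDNestedInternal.mem_foldl_insert_edges]
    simp only [Finset.mem_insert, Finset.mem_image, Finset.mem_range, Finset.notMem_empty, false_or,
      hmem]
    constructor
    · rintro (rfl | ⟨j, hj, rfl⟩)
      · exact ⟨(c i, x i, a₃), Or.inr rfl, rfl⟩
      · exact ⟨(r j, x j, x (j + 1)), Or.inl ⟨j, hj, rfl⟩, rfl⟩
    · rintro ⟨t, (⟨j, hj, rfl⟩ | rfl), rfl⟩
      · exact Or.inr ⟨j, hj, rfl⟩
      · exact Or.inl rfl
  have hends : ∀ i, i < m + 1 → ∀ t ∈ L i, ends t.1 = s(t.2.1, t.2.2) := by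
    intro i hi t ht
    rcases (hmem i t).1 ht with ⟨j, hj, rfl⟩ | rfl
    · exact hr j (by omega)
    · exact hc i (by omega)
  have hchain : ∀ i, List.IsChain (fun t u : E × V × V => u.2.1 = t.2.2) (L i) := by
    intro i
    rw [List.isChain_iff_getElem]
    intro j hj
    simp only [hL, List.length_append, List.length_map, List.length_range,
      List.length_singleton] at hj
    have hji : j < i := by omega
    by_cases hj1 : j + 1 < i
    · simp [hL, hji, hj1]
    · have hi : i = j + 1 := by omega
      subst hi
      simp [hL]
  have hhead : ∀ i, ∀ t ∈ (L i).head?, t.2.1 ∈ ({a₁} : Finset V) := by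
    intro i t ht
    rcases i with _ | i
    · simp only [hL, List.range_zero, List.map_nil, List.nil_append, List.head?_cons,
        Option.mem_def, Option.some.injEq] at ht
      subst ht
      simp [hx0]
    · simp only [hL, List.range_succ_eq_map, List.map_cons, List.cons_append, List.head?_cons,
        Option.mem_def, Option.some.injEq] at ht
      subst ht
      simp [hx0]
  have hwalk : ∀ i, i < m + 1 → ∀ j (hj : j < (L i).length), ((L i).get ⟨j, hj⟩).2.1 ∈
      ({a₁} : Finset V) ∪ (((L i).take j).map (fun u => u.2.2)).toFinset :=
    fun i _ => walk_of_isChain (L i) {a₁} (hhead i) (hchain i)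
  have h3 : ∀ i, i < m + 1 → a₃ ∈ (L i).foldl (fun acc t => insert t.2.2 acc) ({a₁} : Finset V) := by
    intro i _
    rw [mem_foldl_insert_verts]
    exact Or.inr ⟨(c i, x i, a₃), (hmem i _).2 (Or.inr rfl), rfl⟩
  have hnest : ∀ l i, l < i → i < m + 1 →
      (L l).foldl (fun acc t => insert t.2.2 acc) ({a₁} : Finset V) ⊆
        (L i).foldl (fun acc t => insert t.2.2 acc) ({a₁} : Finset V) := by
    intro l i hli _ v hv
    rw [mem_foldl_insert_verts] at hv ⊢
    rcases hv with hv | ⟨t, ht, rfl⟩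
    · exact Or.inl hv
    · rcases (hmem l t).1 ht with ⟨j, hj, rfl⟩ | rfl
      · exact Or.inr ⟨(r j, x j, x (j + 1)), (hmem i _).2 (Or.inl ⟨j, by omega, rfl⟩), rfl⟩
      · exact Or.inr ⟨(c i, x i, a₃), (hmem i _).2 (Or.inr rfl), rfl⟩
  exact CDNestedRoutes.cd_of_nested_routes' p hp (m + 1) L
    (fun i => insert (c i) ((Finset.range i).image r))
    (fun i => (L i).foldl (fun acc t => insert t.2.2 acc) {a₁}) hB (fun _ _ => rfl) hends hwalk h3
    hnest h𝓔 hroute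

/-- **Row 2′CD on every fan graph, for every placement of `a₂` and `o`.** The pure fan `F_m` (vertices
`x 0, …, x m, a₃`, edges the rungs `r j` and the spokes `c i`, nothing else) with `a₁ = x 0`: the row holds
for every `a₂`, every `o`, every up-set and every admissible weight vector. -/
theorem cd_of_fan_graph (p : E → R) (hp : IsProbVec p) {ends : E → Sym2 V} {a₃ : V} (a₂ o : V)
    (m : ℕ) (x : ℕ → V) (r c : ℕ → E) (hr : ∀ j, j < m → ends (r j) = s(x j, x (j + 1)))
    (hc : ∀ i, i ≤ m → ends (c i) = s(x i, a₃))
    (hx : ∀ i j, i ≤ m → j ≤ m → x i = x j → i = j) (ha₃ : ∀ i, i ≤ m → x i ≠ a₃)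
    (hE : ∀ e : E, (∃ j, j < m ∧ e = r j) ∨ (∃ i, i ≤ m ∧ e = c i))
    {𝓔 : Set (Set V)} (h𝓔 : IsUpperSet 𝓔) :
    let Q := (connEvent ends (x 0) a₂)ᶜ
    let U := clusterInEvent ends (x 0) 𝓔
    let e := connEvent ends (x 0) a₃
    let f := connEvent ends a₂ o
    let N := (connEvent ends (x 0) a₃)ᶜ ∩ (connEvent ends a₂ a₃)ᶜ
    let oU := connEvent ends (x 0) o ∪ connEvent ends a₂ o
    prob p (Q ∩ N) * (prob p Q * prob p (Q ∩ U ∩ e ∩ f) - prob p (Q ∩ U) * prob p (Q ∩ e ∩ f)) ≤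
      prob p (Q ∩ N ∩ oU) * (prob p Q * prob p (Q ∩ U ∩ e) - prob p (Q ∩ U) * prob p (Q ∩ e)) :=
  cd_of_fan_bdd p hp (a₂ := a₂) (o := o) m x r c rfl hr hc h𝓔
    fun _ _ h => fan_route_of_conn hr hc hx ha₃ hE h

end Theorem

end CDNestedFan

end Summit.Ventures.PercRepro2
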